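import Mathlib
import Summits.CriticalPhenomena.CardyFormulaZ2.Theorems.CardyMagicRigidityMagicFormulaTRibbonEvents
import Summits.CriticalPhenomena.CardyFormulaZ2.Theorems.CardyMagicRigidityMagicFormulaTRibbonSkeleton
import Summits.CriticalPhenomena.CardyFormulaZ2.Theorems.CardyMagicRigidityMagicFormulaTRibbonCounting
import Summits.CriticalPhenomena.CardyFormulaZ2.Theorems.CardyMagicRigidityMagicFormulaTRibbonArms
import Summits.CriticalPhenomena.CardyFormulaZ2.Theorems.CardyMagicRigidityMagicFormulaTRibbonFourArmSmall
import Literature.Probability.Percolation.SmirnovSeparatingData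
import Summits.CriticalPhenomena.CardyFormulaZ2.Theorems.CardyMagicRigidityNestingRigidityFusionCloudCarriers
import HarnessLib

/-!
# Ribbon rarity, part 2/2: the Peierls bound (crux `MagicFormulaT`, stub R = `stub_ribbonRarity`)

Crux `Summit.CriticalPhenomena.CardyFormulaZ2.Theses.CardyMagicRigidity.MagicFormulaT`
(stmt-CriticalPhenomena-4836), line `Sketch`, skeleton v7 (lead c3).  RIBBON RARITY: for critical site percolation
on `δ𝕋`, the probability that two DISTINCT interface loops `u ≠ v` of diameter `≥ η`, `u` meeting `B̄(0,R)`, are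
globally `2ε`-close (`udist u v ≤ 2ε`) tends to `0` as `ε → 0`, uniformly in `δ ≤ δ₀(ε)` — given the Smirnov–Werner
four-arm scaling limit `SmirnovWerner2001_fourArm_scalingLimit` (named fact, hypothesis).

Proof (Peierls).  `ribbon_fourArmSmall` gives an aspect ratio `L ≥ 2` with `5120 L · π₄(ρ, ρL) ≤ 1` for all
large `ρ`; put `M = 64L`.  On the ribbon event, `ribbon_skeletonPath` produces grid points `p₀, …, p_k ∈ εℤ²`
within `ε` of `u`, pairwise `(M−1)ε` apart, consecutive `≤ (M+1)ε`, `p₀` within `(M+1)ε` of `B̄(0,R)`, with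
`k ≥ k₀ = ⌊η/(2(M+1)ε)⌋₊ − 3`; around each of the first `k₀+1` of them `ribbon_armsAt` gives the reflected
alternating four-arm event across `Λ_{ρL} ∖ Λ_ρ`, `ρ = ⌈5ε/δ⌉₊`.  Hence the ribbon event is covered by
`⋃_{roots} ⋃_{separated shell-walks of length k₀} ⋂ᵢ Eᵢ`; the events along a separated walk are independent
(`rr_real_iInter_reflectArm`) of probability `q ≤ π₄(ρ, ρL) ≤ 1/(5120L)`, the roots are `≤ (2(|R|+(M+1)ε)/ε+3)²`
(`ribbon_gridBallCount`), the walks `≤ (40M)^{k₀}` (`ribbon_shellCount`, `ribbon_walkCount`), so the probability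
is `≤ (K₁/ε)² (40Mq)^{k₀} q ≤ (K₁/ε)² 2^{−k₀} ≤ 16 K₁²/ε² · e^{−c/ε} → 0` (`rr_half_pow_le`, `rr_tail_tendsto`).
-/

noncomputable section

namespace Summit.CriticalPhenomena.CardyFormulaZ2.Cruxes.MagicFormulaT.LineSketch

open MeasureTheory Filter Set
open scoped Real Topology BigOperators ENNReal
open Literature.Probability.RandomPlanarGeometry Literature.Probability.Percolation
  Literature.Probability.LatticeModels

/-! ## Ribbon rarity (part 2/2): the Peierls bound -/

/-- Exponential beats the skeleton count: `(1/2)^{k₀} ≤ 16 e^{−x log 2}` whenever `⌊x⌋₊ ≤ k₀ + 3`. -/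
theorem rr_half_pow_le {x : ℝ} {k₀ : ℕ} (h : ⌊x⌋₊ ≤ k₀ + 3) :
    (1 / 2 : ℝ) ^ k₀ ≤ 16 * Real.exp (-(x * Real.log 2)) := by
  have h1 : (1 / 2 : ℝ) ^ k₀ = 8 * (1 / 2 : ℝ) ^ (k₀ + 3) := by rw [pow_succ, pow_succ, pow_succ]; ring
  have h2 : (1 / 2 : ℝ) ^ (k₀ + 3) ≤ (1 / 2 : ℝ) ^ ⌊x⌋₊ :=
    pow_le_pow_of_le_one (by norm_num) (by norm_num) h
  have h3 : (1 / 2 : ℝ) ^ ⌊x⌋₊ ≤ 2 * Real.exp (-(x * Real.log 2)) := by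
    have hfl : x - 1 < ⌊x⌋₊ := Nat.sub_one_lt_floor x
    have e1 : (1 / 2 : ℝ) ^ ⌊x⌋₊ = Real.exp (-(⌊x⌋₊ * Real.log 2)) := by
      rw [← Real.rpow_natCast, Real.rpow_def_of_pos (by norm_num : (0 : ℝ) < 1 / 2)]
      congr 1
      rw [one_div, Real.log_inv]; ring
    have e2 : (2 : ℝ) * Real.exp (-(x * Real.log 2)) = Real.exp (-((x - 1) * Real.log 2)) := by
      have : -((x - 1) * Real.log 2) = Real.log 2 + -(x * Real.log 2) := by ring
      rw [this, Real.exp_add, Real.exp_log (by norm_num : (0 : ℝ) < 2)]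
    rw [e1, e2, Real.exp_le_exp]
    have hlog : 0 < Real.log 2 := Real.log_pos (by norm_num)
    nlinarith
  calc (1 / 2 : ℝ) ^ k₀ = 8 * (1 / 2 : ℝ) ^ (k₀ + 3) := h1
    _ ≤ 8 * (2 * Real.exp (-(x * Real.log 2))) := by gcongr; exact h2.trans h3
    _ = 16 * Real.exp (-(x * Real.log 2)) := by ring

/-- The analytic tail of the Peierls bound: `K/ε² · e^{−c/ε} → 0` as `ε → 0⁺` (`c > 0`). -/
theorem rr_tail_tendsto (K : ℝ) {c : ℝ} (hc : 0 < c) :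
    Tendsto (fun ε : ℝ ↦ K / ε ^ 2 * Real.exp (-(c / ε))) (𝓝[>] 0) (𝓝 0) := by
  have hy : Tendsto (fun ε : ℝ ↦ c * ε⁻¹) (𝓝[>] 0) atTop :=
    Tendsto.const_mul_atTop hc tendsto_inv_nhdsGT_zero
  have h2 := (Real.tendsto_pow_mul_exp_neg_atTop_nhds_zero 2).comp hy
  have h3 : Tendsto (fun ε : ℝ ↦ K / c ^ 2 * ((c * ε⁻¹) ^ 2 * Real.exp (-(c * ε⁻¹)))) (𝓝[>] 0) (𝓝 0) := by
    simpa using h2.const_mul (K / c ^ 2)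
  refine h3.congr' ?_
  filter_upwards [self_mem_nhdsWithin] with ε hε
  rw [mem_Ioi] at hε
  field_simp

/-- **Stub R (`stub_ribbonRarity`, registered, verbatim signature): ribbon rarity from the Smirnov–Werner
four-arm scaling limit** — no two distinct macroscopic interface loops of critical site percolation on `δ𝕋` are
globally `2ε`-close, w.h.p. as `ε → 0`, uniformly in small meshes.  Peierls bound: see the module docstring. -/
theorem stub_ribbonRarity : SmirnovWerner2001_fourArm_scalingLimit →
    ∀ (R η κ : ℝ), 0 < η → 0 < κ → ∃ ε₀ : ℝ, 0 < ε₀ ∧ ∀ ε : ℝ, 0 < ε → ε ≤ ε₀ →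
      ∃ δ₀ : ℝ, 0 < δ₀ ∧ ∀ δ : ℝ, 0 < δ → δ ≤ δ₀ →
        (triSitePercolation half) {ω | ∃ u ∈ (siteLoopConfig δ ω).loops, ∃ v ∈ (siteLoopConfig δ ω).loops,
          u ≠ v ∧ (u.range ∩ Metric.closedBall (0 : ℂ) R).Nonempty ∧ η ≤ Metric.diam u.range ∧
          η ≤ Metric.diam v.range ∧ u.udist v ≤ 2 * ε} ≤ ENNReal.ofReal κ := by
  intro hSW R η κ hη hκ
  classical
  -- Smirnov–Werner input: an aspect ratio `L` at which the four-arm probability beats `1/(5120 L)`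
  obtain ⟨L, hL2, hev⟩ := ribbon_fourArmSmall hSW 5120 (by norm_num)
  obtain ⟨ρ₀, hρ₀⟩ := Filter.eventually_atTop.1 hev
  have hL1 : 1 ≤ L := by omega
  have hLr : (1 : ℝ) ≤ L := by exact_mod_cast hL1
  -- the skeleton scale multiplier
  set M : ℕ := 64 * L with hMdef
  have hM40 : 40 ≤ M := by omega
  have hMr : (M : ℝ) = 64 * L := by rw [hMdef]; push_cast; ring
  have hMpos : (0 : ℝ) < M := by rw [hMr]; positivity
  -- the analytic tail
  set K₁ : ℝ := 2 * |R| + 2 * M + 5 with hK₁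
  set cst : ℝ := η * Real.log 2 / (2 * (M + 1)) with hcst
  have hlog2 : 0 < Real.log 2 := Real.log_pos (by norm_num)
  have hcpos : 0 < cst := by positivity
  have htail := (tendsto_order.1 (rr_tail_tendsto (16 * K₁ ^ 2) hcpos)).2 (κ / 2) (by positivity)
  obtain ⟨ε₁, hε₁, htail'⟩ := mem_nhdsGT_iff_exists_Ioo_subset.1 htail
  rw [mem_Ioi] at hε₁
  refine ⟨min (ε₁ / 2) (min 1 (η / M)), by positivity, ?_⟩
  intro ε hε hεle
  have hεε₁ : ε < ε₁ := by
    have := (le_min_iff.1 hεle).1; linarith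
  have hε1 : ε ≤ 1 := ((le_min_iff.1 hεle).2).trans (min_le_left _ _)
  have hεM : (M : ℝ) * ε ≤ η := by
    have h := ((le_min_iff.1 hεle).2).trans (min_le_right _ _)
    rwa [le_div_iff₀ hMpos, mul_comm] at h
  -- the mesh threshold
  set ρ₀' : ℕ := max ρ₀ 1 with hρ₀'
  have hρ₀'pos : (0 : ℝ) < ρ₀' := by
    have : (1 : ℝ) ≤ ρ₀' := by exact_mod_cast le_max_right ρ₀ 1
    linarith
  refine ⟨min (ε / 100) (5 * ε / ρ₀'), by positivity, ?_⟩
  intro δ hδ hδle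
  have hδε : 100 * δ ≤ ε := by
    have := (le_min_iff.1 hδle).1; linarith
  have hδρ₀ : δ * ρ₀' ≤ 5 * ε := by
    have := (le_min_iff.1 hδle).2
    rwa [le_div_iff₀ hρ₀'pos] at this
  -- the lattice radii
  set ρ : ℕ := ⌈5 * ε / δ⌉₊ with hρdef
  have hρ5 : 5 * ε ≤ δ * ρ := by
    have h := Nat.le_ceil (5 * ε / δ)
    rw [← hρdef] at h
    rw [div_le_iff₀ hδ] at h
    linarith
  have hρup : δ * ρ ≤ 5 * ε + δ := by
    have h := (Nat.ceil_lt_add_one (by positivity : (0 : ℝ) ≤ 5 * ε / δ)).le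
    rw [← hρdef] at h
    have := mul_le_mul_of_nonneg_left h hδ.le
    calc δ * ρ ≤ δ * (5 * ε / δ + 1) := this
      _ = 5 * ε + δ := by field_simp
  have hρ₀le : ρ₀ ≤ ρ := by
    have h1 : (ρ₀' : ℝ) ≤ ρ := by
      have : δ * ρ₀' ≤ δ * ρ := hδρ₀.trans hρ5
      exact le_of_mul_le_mul_left this hδ
    have h2 : ρ₀' ≤ ρ := by exact_mod_cast h1
    exact (le_max_left _ _).trans h2
  have hr₂ : δ * ((ρ * L : ℕ) : ℝ) ≤ M * ε / 4 := by
    push_cast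
    calc δ * (ρ * L) = (δ * ρ) * L := by ring
      _ ≤ (5 * ε + δ) * L := by gcongr
      _ ≤ (16 * ε) * L := by gcongr; linarith
      _ = M * ε / 4 := by rw [hMr]; ring
  have h12 : ρ ≤ ρ * L := Nat.le_mul_of_pos_right ρ (by omega)
  -- the cost of one skeleton point
  set q : ℝ := (triSitePercolation half).real (altFourArm ρ (ρ * L)) with hqdef
  have hq0 : 0 ≤ q := measureReal_nonneg
  have hq1 : q ≤ 1 := measureReal_le_one
  have hqL : 5120 * L * q ≤ 1 :=
    (mul_le_mul_of_nonneg_left (real_altFourArm_le_critFourArmProb ρ (ρ * L)) (by positivity)).trans (hρ₀ ρ hρ₀le)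
  have h40Mq : 40 * M * q ≤ 1 / 2 := by
    rw [hMr]
    nlinarith
  -- the number of skeleton points
  set x : ℝ := η / (2 * (M + 1) * ε) with hxdef
  have hx0 : 0 ≤ x := by positivity
  set k₀ : ℕ := ⌊x⌋₊ - 3 with hk₀
  have hk₀3 : ⌊x⌋₊ ≤ k₀ + 3 := by omega
  -- rounding of skeleton points to mesh sites
  choose cs hcs using fun z : ℂ ↦ exists_site_dist_le z hδ
  -- roots, neighbours, walks
  obtain ⟨hRootsFin, hRootsCard⟩ := ribbon_gridBallCount ε (|R| + (M + 1) * ε) hε (by positivity)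
  set Roots : Set ℂ := {q : ℂ | (∃ x y : ℤ, q = ε * (x + y * Complex.I)) ∧ dist q 0 ≤ |R| + (M + 1) * ε}
    with hRoots
  set nbr : ℂ → Set ℂ := fun z ↦ {q : ℂ | (∃ x y : ℤ, q = ε * (x + y * Complex.I)) ∧
    ((M : ℝ) - 1) * ε ≤ dist z q ∧ dist z q ≤ ((M : ℝ) + 1) * ε} with hnbr
  have hnbr : ∀ z, (nbr z).Finite ∧ (nbr z).ncard ≤ 40 * M := fun z ↦
    ribbon_shellCount ε M z hε (by omega)
  set W : ℂ → Set (Fin (k₀ + 1) → ℂ) := fun p₀ ↦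
    {w | w 0 = p₀ ∧ ∀ i : Fin k₀, w i.succ ∈ nbr (w i.castSucc)} with hWdef
  have hW : ∀ p₀, (W p₀).Finite ∧ (W p₀).ncard ≤ (40 * M) ^ k₀ := fun p₀ ↦
    ribbon_walkCount ℂ nbr (40 * M) hnbr p₀ k₀
  set W' : ℂ → Set (Fin (k₀ + 1) → ℂ) := fun p₀ ↦
    {w ∈ W p₀ | ∀ i j, i ≠ j → ((M : ℝ) - 1) * ε ≤ dist (w i) (w j)} with hW'def
  have hW'sub : ∀ p₀, W' p₀ ⊆ W p₀ := fun p₀ w hw ↦ hw.1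
  have hW'fin : ∀ p₀, (W' p₀).Finite := fun p₀ ↦ (hW p₀).1.subset (hW'sub p₀)
  -- the covering set
  set Ev : ℂ → Set (SiteConfig (Site 2)) := fun z ↦
    {ω : SiteConfig (Site 2) | (Equiv.subLeft (cs z)) '' ω ∈ altFourArm ρ (ρ * L)} with hEv
  set U : Set (SiteConfig (Site 2)) :=
    ⋃ p₀ ∈ hRootsFin.toFinset, ⋃ w ∈ (hW'fin p₀).toFinset, ⋂ i : Fin (k₀ + 1), Ev (w i) with hUdef
  -- (1) the ribbon event is covered
  have hcover : {ω | ∃ u ∈ (siteLoopConfig δ ω).loops, ∃ v ∈ (siteLoopConfig δ ω).loops,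
      u ≠ v ∧ (u.range ∩ Metric.closedBall (0 : ℂ) R).Nonempty ∧ η ≤ Metric.diam u.range ∧
      η ≤ Metric.diam v.range ∧ u.udist v ≤ 2 * ε} ⊆ U := by
    intro ω hω
    obtain ⟨u, hu, v, hv, huv, ⟨a, hau, haR⟩, hdu, hdv, hud⟩ := hω
    obtain ⟨k, p, hgrid, hinf, hp0, hsep, hcons, hdiam⟩ :=
      ribbon_skeletonPath u.range a ε M u.isCompact_range (NestingRigidity.RingCloudTomography.FusionCloud.isPreconnected_range u) hau hε (by omega)
    -- enough skeleton points
    have hk : k₀ ≤ k := by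
      have h1 : x ≤ (k : ℝ) + 3 := by
        rw [hxdef, div_le_iff₀ (by positivity)]
        have := hdu.trans hdiam
        nlinarith
      have h2 : (⌊x⌋₊ : ℝ) ≤ (k : ℝ) + 3 := (Nat.floor_le hx0).trans h1
      have h3 : ⌊x⌋₊ ≤ k + 3 := by exact_mod_cast h2
      omega
    -- the truncated path
    set w : Fin (k₀ + 1) → ℂ := fun i ↦ p ⟨i, by omega⟩ with hwdef
    have hw_mem : w ∈ W' (p 0) := by
      refine ⟨⟨?_, fun i ↦ ?_⟩, fun i j hij ↦ ?_⟩
      · simp only [hwdef]; rfl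
      · refine ⟨hgrid _, ?_, ?_⟩
        · refine hsep _ _ ?_
          simp only [ne_eq, Fin.mk.injEq, Fin.val_castSucc, Fin.val_succ]; omega
        · have := hcons ⟨i, by omega⟩
          simpa [hwdef] using this
      · refine hsep _ _ ?_
        simp only [ne_eq, Fin.mk.injEq]
        exact fun h ↦ hij (Fin.ext h)
    have hroot : p 0 ∈ hRootsFin.toFinset := by
      rw [Set.Finite.mem_toFinset]
      refine ⟨hgrid 0, ?_⟩
      have haR' : dist a 0 ≤ |R| := (Metric.mem_closedBall.1 haR).trans (le_abs_self R)
      calc dist (p 0) 0 ≤ dist (p 0) a + dist a 0 := dist_triangle _ _ _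
        _ ≤ ((M : ℝ) + 1) * ε + |R| := add_le_add hp0 haR'
        _ = |R| + (M + 1) * ε := by ring
    have harms : ∀ i : Fin (k₀ + 1), ω ∈ Ev (w i) := by
      intro i
      simp only [hEv, Set.mem_setOf_eq]
      refine ribbon_armsAt δ ε M ρ (ρ * L) ω u v (w i) (cs (w i)) hδ hδε hM40 hu hv huv hud (hinf _)
        (hεM.trans hdu) (hεM.trans hdv) (hcs (w i)) hρ5 ?_ h12
      exact_mod_cast hr₂
    simp only [hUdef, Set.mem_iUnion, Set.mem_iInter]
    exact ⟨p 0, hroot, w, (Set.Finite.mem_toFinset _).2 hw_mem, harms⟩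
  -- (2) the measure of the cover
  have hUmeas : (triSitePercolation half).real U ≤ κ / 2 := by
    have hI : ∀ p₀, ∀ w ∈ (hW'fin p₀).toFinset,
        (triSitePercolation half).real (⋂ i : Fin (k₀ + 1), Ev (w i)) = q ^ (k₀ + 1) := by
      intro p₀ w hw
      rw [Set.Finite.mem_toFinset] at hw
      exact rr_real_iInter_reflectArm δ ε M ρ (ρ * L) k₀ w (fun i ↦ cs (w i)) hδ hδε (by omega)
        (by exact_mod_cast hr₂) h12 (fun i ↦ hcs (w i)) hw.2
    calc (triSitePercolation half).real U
        ≤ ∑ p₀ ∈ hRootsFin.toFinset, (triSitePercolation half).real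
            (⋃ w ∈ (hW'fin p₀).toFinset, ⋂ i : Fin (k₀ + 1), Ev (w i)) :=
          measureReal_biUnion_finset_le _ _
      _ ≤ ∑ p₀ ∈ hRootsFin.toFinset, ∑ w ∈ (hW'fin p₀).toFinset,
            (triSitePercolation half).real (⋂ i : Fin (k₀ + 1), Ev (w i)) := by
          gcongr with p₀ _
          exact measureReal_biUnion_finset_le _ _
      _ = ∑ p₀ ∈ hRootsFin.toFinset, ∑ w ∈ (hW'fin p₀).toFinset, q ^ (k₀ + 1) := by
          refine Finset.sum_congr rfl fun p₀ _ ↦ Finset.sum_congr rfl fun w hw ↦ hI p₀ w hw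
      _ ≤ ∑ p₀ ∈ hRootsFin.toFinset, (40 * M : ℝ) ^ k₀ * q ^ (k₀ + 1) := by
          refine Finset.sum_le_sum fun p₀ _ ↦ ?_
          rw [Finset.sum_const, nsmul_eq_mul]
          gcongr
          have h1 : ((hW'fin p₀).toFinset.card : ℝ) ≤ (hW p₀).1.toFinset.card := by
            exact_mod_cast Finset.card_le_card (Set.Finite.toFinset_subset_toFinset.2 (hW'sub p₀))
          have h2 : ((hW p₀).1.toFinset.card : ℝ) ≤ (40 * M : ℝ) ^ k₀ := by
            have := (hW p₀).2
            rw [Set.ncard_eq_toFinset_card _ (hW p₀).1] at this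
            exact_mod_cast this
          exact h1.trans h2
      _ = (hRootsFin.toFinset.card : ℝ) * ((40 * M : ℝ) ^ k₀ * q ^ (k₀ + 1)) := by
          rw [Finset.sum_const, nsmul_eq_mul]
      _ ≤ (2 * (|R| + (M + 1) * ε) / ε + 3) ^ 2 * (1 / 2 : ℝ) ^ k₀ := by
          have hc : (hRootsFin.toFinset.card : ℝ) ≤ (2 * (|R| + (M + 1) * ε) / ε + 3) ^ 2 := by
            rw [Set.ncard_eq_toFinset_card _ hRootsFin] at hRootsCard
            exact hRootsCard
          have hpk : (40 * M : ℝ) ^ k₀ * q ^ (k₀ + 1) ≤ (1 / 2 : ℝ) ^ k₀ := by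
            calc (40 * M : ℝ) ^ k₀ * q ^ (k₀ + 1) = q * (40 * M * q) ^ k₀ := by rw [mul_pow]; ring
              _ ≤ 1 * (1 / 2 : ℝ) ^ k₀ := by gcongr
              _ = (1 / 2 : ℝ) ^ k₀ := one_mul _
          gcongr
      _ ≤ (K₁ / ε) ^ 2 * (16 * Real.exp (-(x * Real.log 2))) := by
          have hA0 : (0 : ℝ) ≤ 2 * (|R| + (M + 1) * ε) / ε + 3 := by positivity
          have hA : 2 * (|R| + (M + 1) * ε) / ε + 3 ≤ K₁ / ε := by
            have e : 2 * (|R| + (M + 1) * ε) / ε + 3 = (2 * |R| + (2 * M + 5) * ε) / ε := by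
              field_simp; ring
            rw [e, hK₁, div_le_div_iff_of_pos_right hε]
            have : (0 : ℝ) ≤ 2 * M + 5 := by positivity
            nlinarith
          exact mul_le_mul (pow_le_pow_left₀ hA0 hA 2) (rr_half_pow_le hk₀3) (by positivity)
            (by positivity)
      _ = 16 * K₁ ^ 2 / ε ^ 2 * Real.exp (-(cst / ε)) := by
          rw [hxdef, hcst]
          field_simp
      _ ≤ κ / 2 := (htail' ⟨hε, hεε₁⟩).le
  -- (3) conclusion
  calc (triSitePercolation half) {ω | ∃ u ∈ (siteLoopConfig δ ω).loops, ∃ v ∈ (siteLoopConfig δ ω).loops,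
          u ≠ v ∧ (u.range ∩ Metric.closedBall (0 : ℂ) R).Nonempty ∧ η ≤ Metric.diam u.range ∧
          η ≤ Metric.diam v.range ∧ u.udist v ≤ 2 * ε}
      ≤ (triSitePercolation half) U := measure_mono hcover
    _ = ENNReal.ofReal ((triSitePercolation half).real U) := (ofReal_measureReal (measure_ne_top _ _)).symm
    _ ≤ ENNReal.ofReal κ := ENNReal.ofReal_le_ofReal (by linarith)

end Summit.CriticalPhenomena.CardyFormulaZ2.Cruxes.MagicFormulaT.LineSketch

end
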